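import Summits.ValiantsHypothesis.ValiantsHypothesis.Theorems.KPlusLogSqLawTropicalBLexCoreLaw
import Summits.ValiantsHypothesis.ValiantsHypothesis.Theorems.KPlusLogSqLawTropicalBParityCensus
import Summits.ValiantsHypothesis.ValiantsHypothesis.Theorems.KPlusLogSqLawTropicalBSplitDefs

/-!
# Route «KPlusLogSqLaw», crux `TropicalB` (stmt-ValiantsHypothesis-19771) — LEX-NT, part 4: THE LEX CENSUS
# «fast digits are never counting-tight at `K = 4`» for EVERY `m ≥ 4` — and every cell (any `K ≥ 4`) ordering the three core slopes

HONEST FRAMING.  Census corollary of the lex core law (`LexCore.lex_core_law`, part 3b `…TropicalBLexCoreLaw`; seat val-sym-trop-p5 g13 conjecture / g14 proof,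
2026-08-28; cell `pub-symmetroid`, `--supports stmt-ValiantsHypothesis-19771 --as helper`).  Finite-format statements about the
UNSIGNED census of dominance designs (`DesignRowD`, `…TropicalBSplitDefs`); an infinite family of deficient cells decided by ONE
three-body exchange mechanism, complementing the parity census (`ParityLaw.parity_census`: `m` EVEN, `K ≥ 5`) with ALL `m ≥ 4` (odd
included) and `K ≥ 4`.  The deficiency proved is ONE histogram per cell — a calibration datum of the lexicographic sector, not a bound of
`TropicalB` shape; nothing here bears on `TropicalB` in its window, `WeakLifting`, DoorA26 / DoorA34, `MatrixDescartes`
(stmt-ValiantsHypothesis-18050) or VP ≠ VNP.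

* `twoOff_of_classSym` — reading the class function off the multiset `{c₃} + {c₂} + (m−2)·{c₀}`.
* `lex_census` — **`m ≥ 4`; classes `d c₀ < d c₁ < d c₂ < d c₃` whose three core slopes are ordered
  `m·d c₂ < (m−1)·d c₁ + d c₃ < (m−2)·d c₀ + d c₂ + d c₃`: every chain of unique optima at strictly increasing slopes with consecutive
  terms distinct has `n + 2 ≤ multichoose K m`** (it misses `c₂^m`, `c₁^{m−1}c₃` or `c₀^{m−2}c₂c₃`).
* `lex_census_superIncreasing` — the same for exponents super-increasing by the size (`d l < d l' → m·d l < d l'`), any four classes: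
  **no lexicographic cell with `m ≥ 4` and at least four distinct exponent values is counting-tight.**
* `designRowD_lex`, `designRowD_fastDigit_four` — `DesignRowD` forms; the `K = 4` column: for every `m ≥ 4` and every `d : Fin 4 → ℕ` with
  `d 0 < d 1 < d 2 < d 3`, `m·d 2 < (m−1)·d 1 + d 3`, `(m−1)·d 1 < (m−2)·d 0 + d 2` (the whole fast-digit cone and more) the `(m,4)` cell has
  `T_D(m,4; d) ≤ C(m+3,3) − 2`; instance `d = (0, 1, m+1, (m+1)²)` for every `m ≥ 4`.  At `m = 3` the fast-digit cell IS tight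
  (`census_three_four`, `(0,1,4,13)`), so `m ≥ 4` is sharp; the staged / odometer mechanism behind every hand-built `K = 4` family loses a
  histogram from `m = 4` on, and counting-tight `(m,4)` cells (`(4,4) = 34`, `(5,4) = 55`) live only where the core slopes are NOT so ordered.
[this cell]
-/

set_option linter.dupNamespace false
set_option autoImplicit false

namespace Summit.ValiantsHypothesis.ValiantsHypothesis.Theorems.KPlusLogSqLaw

namespace LexCore

open Summit.ValiantsHypothesis.ValiantsHypothesis.Theorems.MatrixDescartes.Negative
open Summit.ValiantsHypothesis.ValiantsHypothesis.Theorems.LacunarySymmetroidMatrixDescartes.TropicalCensus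
open Finset

variable {m K : ℕ}

/-- a term whose class multiset is `{c₃} + {c₂} + (m−2)·{c₀}` (`c₀, c₂, c₃` pairwise distinct) has class `c₃` at one column `x`, `c₂` at
another column `y ≠ x`, and `c₀` elsewhere. [folklore] -/
theorem twoOff_of_classSym {p : Equiv.Perm (Fin m) × (Fin m → Fin K)} {c₀ c₂ c₃ : Fin K} (h02 : c₀ ≠ c₂) (h03 : c₀ ≠ c₃)
    (h23 : c₂ ≠ c₃) (h : (classSym p : Multiset (Fin K)) = c₃ ::ₘ c₂ ::ₘ Multiset.replicate (m - 2) c₀) :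
    ∃ x y : Fin m, x ≠ y ∧ p.2 x = c₃ ∧ p.2 y = c₂ ∧ ∀ b, b ≠ x → b ≠ y → p.2 b = c₀ := by
  classical
  have hval : (classSym p : Multiset (Fin K)) = (univ : Finset (Fin m)).val.map p.2 := rfl
  -- columns of class `c₃` and `c₂`
  have hc3 : c₃ ∈ (univ : Finset (Fin m)).val.map p.2 := by rw [← hval, h]; exact Multiset.mem_cons_self _ _
  have hc2 : c₂ ∈ (univ : Finset (Fin m)).val.map p.2 := by
    rw [← hval, h]; exact Multiset.mem_cons_of_mem (Multiset.mem_cons_self _ _)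
  obtain ⟨x, -, hx⟩ := Multiset.mem_map.mp hc3
  obtain ⟨y, -, hy⟩ := Multiset.mem_map.mp hc2
  have hxy : x ≠ y := by intro e; rw [e, hy] at hx; exact h23 hx
  refine ⟨x, y, hxy, hx, hy, fun b hbx hby => ?_⟩
  -- two columns of one class would be counted twice
  have twice : ∀ (c : Fin K) (b₁ b₂ : Fin m), b₁ ≠ b₂ → p.2 b₁ = c → p.2 b₂ = c →
      2 ≤ Multiset.count c ((univ : Finset (Fin m)).val.map p.2) := by
    intro c b₁ b₂ hne h1 h2
    have hsub : (({b₁, b₂} : Finset (Fin m)).val.map p.2) ≤ (univ : Finset (Fin m)).val.map p.2 :=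
      Multiset.map_le_map (Finset.val_le_iff.mpr (Finset.subset_univ _))
    have hpair : ({b₁, b₂} : Finset (Fin m)).val = b₁ ::ₘ {b₂} := by
      rw [Finset.insert_val, Multiset.ndinsert_of_notMem (by simpa using hne)]; rfl
    have htwo : Multiset.count c ((({b₁, b₂} : Finset (Fin m)).val.map p.2)) = 2 := by
      rw [hpair, Multiset.map_cons, Multiset.map_singleton, h1, h2, Multiset.count_cons_self, Multiset.count_singleton_self]
    have := Multiset.count_le_of_le c hsub
    omega
  have count3 : Multiset.count c₃ ((univ : Finset (Fin m)).val.map p.2) = 1 := by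
    rw [← hval, h, Multiset.count_cons_self, Multiset.count_cons_of_ne h23.symm, Multiset.count_replicate, if_neg h03]
  have count2 : Multiset.count c₂ ((univ : Finset (Fin m)).val.map p.2) = 1 := by
    rw [← hval, h, Multiset.count_cons_of_ne h23, Multiset.count_cons_self, Multiset.count_replicate, if_neg h02]
  have hmem : p.2 b ∈ (univ : Finset (Fin m)).val.map p.2 := Multiset.mem_map_of_mem _ (mem_univ b)
  rw [← hval, h, Multiset.mem_cons, Multiset.mem_cons] at hmem
  rcases hmem with hb | hb | hb
  · have := twice c₃ x b (fun e => hbx e.symm) hx hb; omega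
  · have := twice c₂ y b (fun e => hby e.symm) hy hb; omega
  · exact Multiset.eq_of_mem_replicate hb

/-- **THE LEX CENSUS.**  `m ≥ 4`; classes `c₀ c₁ c₂ c₃` with `d c₀ < d c₁ < d c₂ < d c₃` whose core slopes are ordered
`m·d c₂ < (m−1)·d c₁ + d c₃ < (m−2)·d c₀ + d c₂ + d c₃`.  Every chain of unique optima at strictly increasing slopes with consecutive
terms distinct has `n + 2 ≤ multichoose K m`: it misses one of the histograms `c₂^m`, `c₁^{m−1} c₃`, `c₀^{m−2} c₂ c₃`. [this cell] -/
theorem lex_census (hm : 4 ≤ m) (d : Fin K → ℕ) (v ε : Fin m → Fin m → Fin K → ℤ) (c₀ c₁ c₂ c₃ : Fin K)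
    (h01 : d c₀ < d c₁) (h12 : d c₁ < d c₂) (h23 : d c₂ < d c₃)
    (hAB : (m : ℤ) * d c₂ < (m - 1 : ℤ) * d c₁ + d c₃) (hBC : (m - 1 : ℤ) * d c₁ + d c₃ < (m - 2 : ℤ) * d c₀ + d c₂ + d c₃)
    {n : ℕ} (θ : Fin (n + 1) → ℤ) (p : Fin (n + 1) → Equiv.Perm (Fin m) × (Fin m → Fin K))
    (hθ : StrictMono θ) (hdom : ∀ k, IsDominant d v ε (θ k) (p k)) (hne : ∀ k : Fin n, p k.castSucc ≠ p k.succ) :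
    n + 2 ≤ Nat.multichoose K m := by
  classical
  by_contra hlt
  have hn : Nat.multichoose K m ≤ n + 1 := by omega
  obtain ⟨hsm, hsurj⟩ := ParityLaw.classSym_surjective_of_full d v ε θ p hθ hdom hne hn
  -- the three core multisets
  have cardA : Multiset.card (Multiset.replicate m c₂) = m := Multiset.card_replicate _ _
  have cardB : Multiset.card (c₃ ::ₘ Multiset.replicate (m - 1) c₁) = m := by
    rw [Multiset.card_cons, Multiset.card_replicate]; omega
  have cardC : Multiset.card (c₃ ::ₘ c₂ ::ₘ Multiset.replicate (m - 2) c₀) = m := by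
    rw [Multiset.card_cons, Multiset.card_cons, Multiset.card_replicate]; omega
  obtain ⟨kA, hkA⟩ := hsurj ⟨Multiset.replicate m c₂, cardA⟩
  obtain ⟨kB, hkB⟩ := hsurj ⟨c₃ ::ₘ Multiset.replicate (m - 1) c₁, cardB⟩
  obtain ⟨kC, hkC⟩ := hsurj ⟨c₃ ::ₘ c₂ ::ₘ Multiset.replicate (m - 2) c₀, cardC⟩
  have hkA' : (classSym (p kA) : Multiset (Fin K)) = Multiset.replicate m c₂ := congrArg Subtype.val hkA
  have hkB' : (classSym (p kB) : Multiset (Fin K)) = c₃ ::ₘ Multiset.replicate (m - 1) c₁ := congrArg Subtype.val hkB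
  have hkC' : (classSym (p kC) : Multiset (Fin K)) = c₃ ::ₘ c₂ ::ₘ Multiset.replicate (m - 2) c₀ := congrArg Subtype.val hkC
  -- shapes
  have hlA : ∀ b, (p kA).2 b = c₂ := ParityLaw.const_of_classSym_replicate hkA'
  obtain ⟨bs, hbs, hlB⟩ := ParityLaw.oneOff_of_classSym_cons (fun h => (ne_of_lt (h12.trans h23)) (by rw [h])) hkB'
  obtain ⟨x, y, hxy, hx, hy, hlC⟩ := twoOff_of_classSym (c₀ := c₀) (c₂ := c₂) (c₃ := c₃)
    (fun h => (ne_of_lt (h01.trans h12)) (by rw [h])) (fun h => (ne_of_lt ((h01.trans h12).trans h23)) (by rw [h]))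
    (fun h => (ne_of_lt h23) (by rw [h])) hkC'
  -- slopes of the three terms
  have slA : slope d (p kA) = (m : ℤ) * d c₂ := by
    rw [slope_eq_of_classSym, hkA', Multiset.map_replicate, Multiset.sum_replicate, nsmul_eq_mul]
  have slB : slope d (p kB) = (d c₃ : ℤ) + (m - 1 : ℤ) * d c₁ := by
    rw [slope_eq_of_classSym, hkB', Multiset.map_cons, Multiset.sum_cons, Multiset.map_replicate, Multiset.sum_replicate,
      nsmul_eq_mul]
    push_cast [Nat.cast_sub (by omega : 1 ≤ m)]
    ring
  have slC : slope d (p kC) = (d c₃ : ℤ) + d c₂ + (m - 2 : ℤ) * d c₀ := by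
    rw [slope_eq_of_classSym, hkC', Multiset.map_cons, Multiset.sum_cons, Multiset.map_cons, Multiset.sum_cons, Multiset.map_replicate,
      Multiset.sum_replicate, nsmul_eq_mul]
    push_cast [Nat.cast_sub (by omega : 2 ≤ m)]
    ring
  -- index order from slope order
  have hAB' : kA < kB := by
    have hs : slope d (p kA) < slope d (p kB) := by rw [slA, slB]; linarith
    exact hsm.lt_iff_lt.mp hs
  have hBC' : kB < kC := by
    have hs : slope d (p kB) < slope d (p kC) := by rw [slB, slC]; linarith
    exact hsm.lt_iff_lt.mp hs
  -- the lex core law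
  exact lex_core_law_chain hm d v ε c₀ c₁ c₂ c₃ h01 h12 h23.le θ p hθ hdom hAB' hBC' bs x y hxy hlA hlB hbs hlC hx hy

/-- **LEX CENSUS, `DesignRowD` form**: under the hypotheses of `lex_census` the design's unsigned row is at most `multichoose K m − 2`,
one below slope counting (`tropRowD_slopeCount`). [this cell] -/
theorem designRowD_lex (hm : 4 ≤ m) (d : Fin K → ℕ) (v ε : Fin m → Fin m → Fin K → ℤ) (c₀ c₁ c₂ c₃ : Fin K)
    (h01 : d c₀ < d c₁) (h12 : d c₁ < d c₂) (h23 : d c₂ < d c₃)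
    (hAB : (m : ℤ) * d c₂ < (m - 1 : ℤ) * d c₁ + d c₃) (hBC : (m - 1 : ℤ) * d c₁ + d c₃ < (m - 2 : ℤ) * d c₀ + d c₂ + d c₃) :
    DesignRowD d v ε (Nat.multichoose K m - 2) := by
  intro n θ p hθ hdom hne
  have := lex_census hm d v ε c₀ c₁ c₂ c₃ h01 h12 h23 hAB hBC θ p hθ hdom hne
  omega

/-- **LEX CENSUS IN THE SUPER-INCREASING SECTOR.**  `m ≥ 4`, exponents super-increasing by the size (`d l < d l' → m·d l < d l'`, the
hypothesis of `ParityLaw.parity_census_lex`), four classes with strictly increasing exponents: every chain has `n + 2 ≤ multichoose K m`.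
**No lexicographic cell with `m ≥ 4` and at least four distinct exponent values is counting-tight** (all `m`, complementing the parity
census's even `m` / five values). [this cell] -/
theorem lex_census_superIncreasing (hm : 4 ≤ m) (d : Fin K → ℕ) (hsup : ∀ l l' : Fin K, d l < d l' → m * d l < d l')
    (v ε : Fin m → Fin m → Fin K → ℤ) (c₀ c₁ c₂ c₃ : Fin K) (h01 : d c₀ < d c₁) (h12 : d c₁ < d c₂) (h23 : d c₂ < d c₃)
    {n : ℕ} (θ : Fin (n + 1) → ℤ) (p : Fin (n + 1) → Equiv.Perm (Fin m) × (Fin m → Fin K))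
    (hθ : StrictMono θ) (hdom : ∀ k, IsDominant d v ε (θ k) (p k)) (hne : ∀ k : Fin n, p k.castSucc ≠ p k.succ) :
    n + 2 ≤ Nat.multichoose K m := by
  have h3 := hsup c₂ c₃ h23   -- m·d c₂ < d c₃
  have h2 := hsup c₁ c₂ h12   -- m·d c₁ < d c₂
  have h3' : (m : ℤ) * d c₂ < d c₃ := by exact_mod_cast h3
  have h2' : (m : ℤ) * d c₁ < d c₂ := by exact_mod_cast h2
  have hm' : (4 : ℤ) ≤ m := by exact_mod_cast hm
  refine lex_census hm d v ε c₀ c₁ c₂ c₃ h01 h12 h23 ?_ ?_ θ p hθ hdom hne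
  · nlinarith [Nat.cast_nonneg (α := ℤ) (d c₁)]
  · nlinarith [Nat.cast_nonneg (α := ℤ) (d c₀), Nat.cast_nonneg (α := ℤ) (d c₁)]

/-- **THE `K = 4` COLUMN: FAST DIGITS ARE NEVER COUNTING-TIGHT (`m ≥ 4`).**  For `d : Fin 4 → ℕ` with `d 0 < d 1 < d 2 < d 3` and the core
slopes ordered (`m·d 2 < (m−1)·d 1 + d 3`, `(m−1)·d 1 < (m−2)·d 0 + d 2` — e.g. the whole fast-digit cone `m(d 1 − d 0) ≤ d 2 − d 0`,
`m(d 2 − d 0) ≤ d 3 − d 0`), every `(m,4)` design with exponents `d` has unsigned row `≤ multichoose 4 m − 2 = C(m+3,3) − 2`.  Kernel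
predecessors: `m = 4` on the closed fast-digit cell (`designRowD_four_four_33_LEX`, 360 certificates); `m = 3` is tight (`census_three_four`).
[this cell] -/
theorem designRowD_fastDigit_four (hm : 4 ≤ m) (d : Fin 4 → ℕ) (h01 : d 0 < d 1) (h12 : d 1 < d 2) (h23 : d 2 < d 3)
    (hAB : (m : ℤ) * d 2 < (m - 1 : ℤ) * d 1 + d 3) (hBC : (m - 1 : ℤ) * d 1 < (m - 2 : ℤ) * d 0 + d 2)
    (v ε : Fin m → Fin m → Fin 4 → ℤ) : DesignRowD d v ε (Nat.multichoose 4 m - 2) :=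
  designRowD_lex hm d v ε 0 1 2 3 h01 h12 h23 hAB (by linarith)

/-- the fast-digit instance `d = (0, 1, m+1, (m+1)²)`, every `m ≥ 4`. [this cell] -/
theorem designRowD_fastDigit_four_example (hm : 4 ≤ m) (v ε : Fin m → Fin m → Fin 4 → ℤ) :
    DesignRowD ![0, 1, m + 1, (m + 1) ^ 2] v ε (Nat.multichoose 4 m - 2) := by
  have e0 : (![0, 1, m + 1, (m + 1) ^ 2] : Fin 4 → ℕ) 0 = 0 := rfl
  have e1 : (![0, 1, m + 1, (m + 1) ^ 2] : Fin 4 → ℕ) 1 = 1 := rfl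
  have e2 : (![0, 1, m + 1, (m + 1) ^ 2] : Fin 4 → ℕ) 2 = m + 1 := rfl
  have e3 : (![0, 1, m + 1, (m + 1) ^ 2] : Fin 4 → ℕ) 3 = (m + 1) ^ 2 := rfl
  refine designRowD_fastDigit_four hm _ ?_ ?_ ?_ ?_ ?_ v ε
  · rw [e0, e1]; omega
  · rw [e1, e2]; omega
  · rw [e2, e3]; nlinarith
  · rw [e1, e2, e3]; push_cast; nlinarith
  · rw [e0, e1, e2]; push_cast; nlinarith

/-- the census value in binomial form: `multichoose 4 m − 2 = C(m+3,3) − 2`. [folklore] -/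
theorem multichoose_four_eq (m : ℕ) : Nat.multichoose 4 m = (m + 3).choose 3 := by
  rw [Nat.multichoose_eq, show 4 + m - 1 = m + 3 by omega, Nat.choose_symm_add]

end LexCore

end Summit.ValiantsHypothesis.ValiantsHypothesis.Theorems.KPlusLogSqLaw
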